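import Summits.AtomisticToContinuum.HydrodynamicLimit.Theorems.MourreKoopmanChargesLinearToEntropyInBandFastCollisionThroughputOfEnvelope
import Summits.AtomisticToContinuum.HydrodynamicLimit.Theorems.MourreKoopmanChargesLinearToEntropyInBandContinuityOfEnvelopePrep
import Summits.AtomisticToContinuum.HydrodynamicLimit.Theses.BGEndpointRigidity
import HarnessLib

/-!
# Crux `MourreKoopmanCharges.LinearToEntropyInBand` (stmt-AtomisticToContinuum-17740), line `registered`:
# wave-4 glue — the PER-WINDOW fast-collision throughput from `LanfordEnvelopeR` (v7 stub 4a-iii, fast half)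

Helper file (`--supports stmt-AtomisticToContinuum-17740`).  The wave-3 architecture audit of stub 4a
(`stub_windowClauseVisibleInBand`) found that the INTEGRATED fast-collision throughput
`FastCollisionThroughputBelow η` (stmt-13022 guarded: `(N+1)^{-4/3} E[Σ over all collisions in (0, t]]`,
landed from the Lanford envelope in p155741) cannot serve the PER-WINDOW clause `WindowClauseInBand`
(one micro window `(s, s + w]`, `w = τ (N+1)^{-1/3}`, may host all fast collisions: off by `(N+1)^{1/3}/τ`).
The per-window input that skeleton v7's Yau bookkeeping (stub 4a-ii) consumes is, for its FAST half,

  `∀ t < T ∀ η' > 0 ∃ K₀ ∀ K ≥ K₀ ∃ τ₀ > 0 ∀ τ ≥ τ₀ ∃ N₀ ∀ N ≥ N₀ ∀ s ∈ [0, t]`,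
  `(τ (N+1))⁻¹ E[Σᵢ Σ_{collision times s' ∈ (s, s + w]} 𝟙{K < max(‖vᵢ(s'⁻)‖, ‖vᵢ(s')‖)}
      (1 + ‖vᵢ(s') + vᵢ(s'⁻)‖/2) ‖vᵢ(s') − vᵢ(s'⁻)‖] ≤ η'`

under the TRUE law `localGibbsLaw σ a₀ u₀ θ₀ N (Φ N)` (one micro window holds `≍ τ (N+1)` collisions).
This file derives it — UNGUARDED (no packing guard on the Euler solution; the envelope has none) — from
the by-name open input `Theses.BGEndpointRigidity.LanfordEnvelopeR` (stmt-13677), mirroring per window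
what p155741 did on `(0, t]`:

* `fastMark_antitone` — the fast mark `b_K(v, w) = 𝟙{K² < ‖v‖² + ‖w‖²} 2 (1 + ‖v‖ + ‖w‖) ‖v − w‖` is
  antitone in the level `K ≥ 0` (the statement quantifies `∀ K ≥ K₀`, the Gaussian tail
  `tendsto_fastMarkFlux` runs along `ℕ`);
* `ofReal_windowThroughput_le_markSum` — the pathwise bookkeeping of p155741
  (`ofReal_throughput_le_markSum`, window `(0, t] ⊆ [0, τ]`) on a GENERAL window `(s₁, s₁ + w] ⊆ [s₁, s₁ + w]`:
  at a collision time only the two partners jump and their jump weights are dominated by the fast mark of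
  the post-collisional pair (`jumpWeight_collidePair_le`, `leftLim_eq_collidePair`);
* `lintegral_windowThroughput_le_of_pairEnvelope` — mean form per window: under any law carried by the
  good set with a pair envelope `C · (Haar ⊗ γ)^{⊗2}` at the times of the window,
  `E[Σᵢ Σ_{s' ∈ (s₁, s₁+w]} W_K] ≤ 4 C w (N+1)² ε_N² · ∫ ‖w − v‖ b_K dγ dγ` (the non-stationary one-window /
  Campbell inequality `CollisionEnergyExchangeMeanBound.lintegral_windowCollisionSum_le_of_pairEnvelope`);
* `fastCollisionThroughputWAt_of_pairEnvelope` — the per-window statement at a fixed profile from the pair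
  conjunct of hypothesis (A) of crux `CollisionRate` on the horizon `[0, t + 1]`: with `w = τ ν_N`,
  `ν_N = (N+1)^{-1/3}`, the normalisation `(τ (N+1))⁻¹ · 4 C (τ ν_N) (N+1)² ε_N² = 4 C σ²` is free of
  `τ, N, s`, so `K₀ ∈ ℕ` is fixed by `4 C σ² · ∫ ‖w − v‖ b_{K₀} dN(u,θ)^{⊗2} ≤ η'` (`tendsto_fastMarkFlux`),
  `τ₀ = 1`, and `N₀(τ)` by `τ ν_N ≤ 1` (the window stays inside the horizon) and the envelope's threshold;
* `glue_fastCollisionThroughputW_of_lanfordEnvelopeR` (REGISTERED glue) — by name from `LanfordEnvelopeR`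
  through `CollisionRate.stub_marginalEnvelopeLG_of_lanfordEnvelopeR`; and the two-line guarded corollary
  `glue_fastCollisionThroughputW_inBand_of_lanfordEnvelopeR` (the packing guard `ρ σ³ < η` is ignored), whose
  conclusion is the body of the Defs-module object `LTEInBand.FastCollisionThroughputW η` (wave 4, typed in
  parallel; inline-expanded here).

No definitions; nothing here restates the crux, the route's items or the Statement; `LanfordEnvelopeR`
enters only as a hypothesis.  References: C. Cercignani, R. Illner, M. Pulvirenti, *The Mathematical
Theory of Dilute Gases* (1994) §4.2, App. 4.A; I. Gallagher, L. Saint-Raymond, B. Texier, *From Newton to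
Boltzmann* (2013) Ch. 4–6; H.-T. Yau, Lett. Math. Phys. 22 (1991) §2.
-/

noncomputable section

open MeasureTheory Filter Set Topology
open scoped ENNReal InnerProductSpace BigOperators

namespace Summit.AtomisticToContinuum.HydrodynamicLimit.Theorems.LTEInBand

open Literature.Analysis.FluidPDE Literature.MathematicalPhysics.KineticTheory
open Summit.AtomisticToContinuum.HydrodynamicLimit.Theses

/-! ## §1 The fast mark is antitone in the level -/

/-- The fast mark `b_K(v, w) = 𝟙{K² < ‖v‖² + ‖w‖²} 2 (1 + ‖v‖ + ‖w‖) ‖v − w‖` is antitone in the level on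
`K ≥ 0`: raising the level shrinks the indicator. -/
theorem fastMark_antitone {K K' : ℝ} (hK : 0 ≤ K) (hKK' : K ≤ K') (p : V3 × V3) :
    (if K' ^ 2 < ‖p.1‖ ^ 2 + ‖p.2‖ ^ 2 then 2 * ((1 + ‖p.1‖ + ‖p.2‖) * ‖p.1 - p.2‖) else 0) ≤
      (if K ^ 2 < ‖p.1‖ ^ 2 + ‖p.2‖ ^ 2 then 2 * ((1 + ‖p.1‖ + ‖p.2‖) * ‖p.1 - p.2‖) else 0) := by
  by_cases h : K' ^ 2 < ‖p.1‖ ^ 2 + ‖p.2‖ ^ 2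
  · have h' : K ^ 2 < ‖p.1‖ ^ 2 + ‖p.2‖ ^ 2 := (pow_le_pow_left₀ hK hKK' 2).trans_lt h
    rw [if_pos h, if_pos h']
  · rw [if_neg h]
    split_ifs <;> positivity

/-- The Gaussian-type flux integral of the fast mark, `∫ ‖w − v‖ b_K(v, w) dμ`, is antitone in the level on
`K ≥ 0` (pointwise, `fastMark_antitone`). -/
theorem lintegral_fastMarkFlux_antitone (μ : Measure (V3 × V3)) {K K' : ℝ} (hK : 0 ≤ K) (hKK' : K ≤ K') :
    ∫⁻ p, ENNReal.ofReal ‖p.2 - p.1‖ *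
        ENNReal.ofReal (if K' ^ 2 < ‖p.1‖ ^ 2 + ‖p.2‖ ^ 2 then 2 * ((1 + ‖p.1‖ + ‖p.2‖) * ‖p.1 - p.2‖) else 0) ∂μ ≤
      ∫⁻ p, ENNReal.ofReal ‖p.2 - p.1‖ *
        ENNReal.ofReal (if K ^ 2 < ‖p.1‖ ^ 2 + ‖p.2‖ ^ 2 then 2 * ((1 + ‖p.1‖ + ‖p.2‖) * ‖p.1 - p.2‖) else 0) ∂μ :=
  lintegral_mono fun p => mul_le_mul' le_rfl (ENNReal.ofReal_le_ofReal (fastMark_antitone hK hKK' p))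

/-! ## §2 Pathwise bookkeeping on a general window -/

/-- **Pathwise bookkeeping on a general window (the crux functional is charged to the contact pairs).**
Along a hard-sphere trajectory `γ` (diameter `ε`, `𝕋³`), for a level `K ≥ 0` and a window `(s₁, s₁ + w]`:
the per-particle fast-collision throughput summed over the collision times in `(s₁, s₁ + w]` is at most the
sum over the collision times in the CLOSED window `[s₁, s₁ + w]` of the fast marks of the ordered contact
pairs (the inline double-sum form of `lintegral_windowCollisionSum_le_of_pairEnvelope`).  The window-`(0, t]`
case is p155741's `ofReal_throughput_le_markSum`; same proof: at a collision time the left limit is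
`collidePair` of the colliding pair (`leftLim_eq_collidePair`), only the partners jump
(`jumpWeight_collidePair_le`), honest finite sums (`IsHardSphereTrajectory.locFinite`). -/
theorem ofReal_windowThroughput_le_markSum {n : ℕ} {ε : ℝ} {γ : ℝ → Config n (Fin 3) T3}
    (h : IsHardSphereTrajectory (Torus.geometry (Fin 3)) ε n γ) {K : ℝ} (hK : 0 ≤ K) (s₁ w : ℝ) :
    ENNReal.ofReal (∑ i : Fin n, ∑ᶠ s ∈ collisionTimes (Torus.geometry (Fin 3)) ε γ ∩ Set.Ioc s₁ (s₁ + w),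
        (if K < max ‖(Function.leftLim γ s i).2‖ ‖(γ s i).2‖ then
          (1 + ‖(γ s i).2 + (Function.leftLim γ s i).2‖ / 2) * ‖(γ s i).2 - (Function.leftLim γ s i).2‖
          else 0)) ≤
      ∑ᶠ s ∈ collisionTimes (Torus.geometry (Fin 3)) ε γ ∩ Set.Icc s₁ (s₁ + w),
        ∑ i : Fin n, ∑ j : Fin n,
          (if i ≠ j ∧ ‖(Torus.geometry (Fin 3)).sepVec (γ s i).1 (γ s j).1‖ = ε then
            ENNReal.ofReal (if K ^ 2 < ‖(γ s i).2‖ ^ 2 + ‖(γ s j).2‖ ^ 2 then 2 * ((1 + ‖(γ s i).2‖ + ‖(γ s j).2‖) * ‖(γ s i).2 - (γ s j).2‖) else 0) else 0) := by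
  -- adapted from `ofReal_throughput_le_markSum` (p155741): window `(s₁, s₁ + w] ⊆ [s₁, s₁ + w]`
  classical
  set G : Geometry (Fin 3) T3 := Torus.geometry (Fin 3) with hG
  -- the per-time right-hand side
  set R : ℝ → ℝ≥0∞ := fun s => ∑ i : Fin n, ∑ j : Fin n,
    (if i ≠ j ∧ ‖G.sepVec (γ s i).1 (γ s j).1‖ = ε then
      ENNReal.ofReal (if K ^ 2 < ‖(γ s i).2‖ ^ 2 + ‖(γ s j).2‖ ^ 2 then 2 * ((1 + ‖(γ s i).2‖ + ‖(γ s j).2‖) * ‖(γ s i).2 - (γ s j).2‖) else 0) else 0) with hR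
  change _ ≤ ∑ᶠ s ∈ collisionTimes G ε γ ∩ Set.Icc s₁ (s₁ + w), R s
  have hS' : (collisionTimes G ε γ ∩ Set.Icc s₁ (s₁ + w)).Finite := h.locFinite s₁ (s₁ + w)
  have hsub : collisionTimes G ε γ ∩ Set.Ioc s₁ (s₁ + w) ⊆ collisionTimes G ε γ ∩ Set.Icc s₁ (s₁ + w) :=
    Set.inter_subset_inter_right _ Set.Ioc_subset_Icc_self
  have hS : (collisionTimes G ε γ ∩ Set.Ioc s₁ (s₁ + w)).Finite := hS'.subset hsub
  -- one collision time: only the colliding pair jumps, and its weights are dominated by the mark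
  have hper : ∀ s ∈ collisionTimes G ε γ,
      ENNReal.ofReal (∑ i : Fin n, (if K < max ‖(Function.leftLim γ s i).2‖ ‖(γ s i).2‖ then (1 + ‖(γ s i).2 + (Function.leftLim γ s i).2‖ / 2) * ‖(γ s i).2 - (Function.leftLim γ s i).2‖ else 0)) ≤ R s := by
    intro s hs
    obtain ⟨p, q, hpq, hc⟩ := mem_collisionTimes.1 hs
    have hL : Function.leftLim γ s = collidePair G p q (γ s) := h.leftLim_eq_collidePair hpq hc
    have hsum : ∑ i : Fin n, (if K < max ‖(Function.leftLim γ s i).2‖ ‖(γ s i).2‖ then (1 + ‖(γ s i).2 + (Function.leftLim γ s i).2‖ / 2) * ‖(γ s i).2 - (Function.leftLim γ s i).2‖ else 0) =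
        (if K < max ‖(collidePair G p q (γ s) p).2‖ ‖(γ s p).2‖ then (1 + ‖(γ s p).2 + (collidePair G p q (γ s) p).2‖ / 2) * ‖(γ s p).2 - (collidePair G p q (γ s) p).2‖ else 0) +
          (if K < max ‖(collidePair G p q (γ s) q).2‖ ‖(γ s q).2‖ then (1 + ‖(γ s q).2 + (collidePair G p q (γ s) q).2‖ / 2) * ‖(γ s q).2 - (collidePair G p q (γ s) q).2‖ else 0) := by
      rw [hL]
      refine Finset.sum_eq_add_of_mem p q (Finset.mem_univ _) (Finset.mem_univ _) hpq ?_
      intro k _ hk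
      rw [collidePair_apply_of_ne hk.1 hk.2]
      simp
    have hcontact : ‖G.sepVec (γ s p).1 (γ s q).1‖ = ε := (mem_contactSet.1 hc).2
    calc ENNReal.ofReal (∑ i : Fin n, (if K < max ‖(Function.leftLim γ s i).2‖ ‖(γ s i).2‖ then (1 + ‖(γ s i).2 + (Function.leftLim γ s i).2‖ / 2) * ‖(γ s i).2 - (Function.leftLim γ s i).2‖ else 0))
        ≤ ENNReal.ofReal (if K ^ 2 < ‖(γ s p).2‖ ^ 2 + ‖(γ s q).2‖ ^ 2 then 2 * ((1 + ‖(γ s p).2‖ + ‖(γ s q).2‖) * ‖(γ s p).2 - (γ s q).2‖) else 0) := by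
          rw [hsum]
          exact ENNReal.ofReal_le_ofReal (jumpWeight_collidePair_le G hpq (γ s) hK)
      _ = (if p ≠ q ∧ ‖G.sepVec (γ s p).1 (γ s q).1‖ = ε then
            ENNReal.ofReal (if K ^ 2 < ‖(γ s p).2‖ ^ 2 + ‖(γ s q).2‖ ^ 2 then 2 * ((1 + ‖(γ s p).2‖ + ‖(γ s q).2‖) * ‖(γ s p).2 - (γ s q).2‖) else 0) else 0) := by
          rw [if_pos (show p ≠ q ∧ ‖G.sepVec (γ s p).1 (γ s q).1‖ = ε from ⟨hpq, hcontact⟩)]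
      _ ≤ ∑ j : Fin n, (if p ≠ j ∧ ‖G.sepVec (γ s p).1 (γ s j).1‖ = ε then
            ENNReal.ofReal (if K ^ 2 < ‖(γ s p).2‖ ^ 2 + ‖(γ s j).2‖ ^ 2 then 2 * ((1 + ‖(γ s p).2‖ + ‖(γ s j).2‖) * ‖(γ s p).2 - (γ s j).2‖) else 0) else 0) :=
          Finset.single_le_sum (f := fun j => (if p ≠ j ∧ ‖G.sepVec (γ s p).1 (γ s j).1‖ = ε then
            ENNReal.ofReal (if K ^ 2 < ‖(γ s p).2‖ ^ 2 + ‖(γ s j).2‖ ^ 2 then 2 * ((1 + ‖(γ s p).2‖ + ‖(γ s j).2‖) * ‖(γ s p).2 - (γ s j).2‖) else 0) else 0)) (fun _ _ => zero_le)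
            (Finset.mem_univ q)
      _ ≤ R s :=
          Finset.single_le_sum (f := fun i => ∑ j : Fin n, (if i ≠ j ∧ ‖G.sepVec (γ s i).1 (γ s j).1‖ = ε
            then ENNReal.ofReal (if K ^ 2 < ‖(γ s i).2‖ ^ 2 + ‖(γ s j).2‖ ^ 2 then 2 * ((1 + ‖(γ s i).2‖ + ‖(γ s j).2‖) * ‖(γ s i).2 - (γ s j).2‖) else 0) else 0)) (fun _ _ => zero_le)
            (Finset.mem_univ p)
  -- honest finite sums, swap, and enlarge the window
  simp_rw [finsum_mem_eq_finite_toFinset_sum _ hS]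
  rw [finsum_mem_eq_finite_toFinset_sum _ hS', Finset.sum_comm,
    ENNReal.ofReal_sum_of_nonneg fun s _ => Finset.sum_nonneg fun i _ => jumpWeight_nonneg _ _ _]
  calc ∑ s ∈ hS.toFinset, ENNReal.ofReal (∑ i : Fin n, (if K < max ‖(Function.leftLim γ s i).2‖ ‖(γ s i).2‖ then (1 + ‖(γ s i).2 + (Function.leftLim γ s i).2‖ / 2) * ‖(γ s i).2 - (Function.leftLim γ s i).2‖ else 0))
      ≤ ∑ s ∈ hS.toFinset, R s :=
        Finset.sum_le_sum fun s hs => hper s ((Set.Finite.mem_toFinset hS).1 hs).1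
    _ ≤ ∑ s ∈ hS'.toFinset, R s :=
        Finset.sum_le_sum_of_subset_of_nonneg (Set.Finite.toFinset_subset_toFinset.2 hsub)
          fun _ _ _ => zero_le

/-! ## §3 Mean form per window -/

/-- **Mean form per window.** For a flow `Φ` of `N + 1` spheres of diameter `ε_N = σ (N+1)^{-1/3}`, a law `P`
carried by the good set whose pair marginals at the times `r ∈ [s₁, s₁ + w]` (`0 < w`) are dominated by
`C · (Haar ⊗ γ)^{⊗2}`, and a level `K ≥ 0`: the expected fast-collision throughput of the window `(s₁, s₁ + w]`
is at most `4 C w (N+1)² ε_N² · ∫ ‖w − v‖ b_K(v, w) dγ dγ` (`ofReal_windowThroughput_le_markSum` in mean and the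
non-stationary one-window / Campbell inequality `lintegral_windowCollisionSum_le_of_pairEnvelope`, CIP 1994
App. 4.A). -/
theorem lintegral_windowThroughput_le_of_pairEnvelope {σ : ℝ} (hσ : 0 < σ) {N : ℕ}
    (Φ : HardSphereFlow (Torus.geometry (Fin 3)) (hsDiameter σ N) (N + 1))
    (P : Measure (Config (N + 1) (Fin 3) T3)) (hP : P Φ.goodᶜ = 0) (s₁ : ℝ) {w : ℝ} (hw : 0 < w)
    {C : ℝ} (hC : 0 ≤ C) (γ : Measure V3) [SFinite γ]
    (henv : ∀ r ∈ Set.Icc s₁ (s₁ + w), ∀ i j : Fin (N + 1), i ≠ j →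
      ∀ f : (T3 × V3) × (T3 × V3) → ℝ≥0∞, Measurable f →
      ∫⁻ z, f (Φ.flow r z i, Φ.flow r z j) ∂P ≤
        ENNReal.ofReal C * ∫⁻ q, f q ∂(((volume : Measure T3).prod γ).prod ((volume : Measure T3).prod γ)))
    {K : ℝ} (hK : 0 ≤ K) :
    ∫⁻ z, ENNReal.ofReal (∑ i : Fin (N + 1),
        ∑ᶠ s ∈ collisionTimes (Torus.geometry (Fin 3)) (hsDiameter σ N) (fun r => Φ.flow r z) ∩ Set.Ioc s₁ (s₁ + w),
          (if K < max ‖(Function.leftLim (fun r => Φ.flow r z) s i).2‖ ‖(Φ.flow s z i).2‖ then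
            (1 + ‖(Φ.flow s z i).2 + (Function.leftLim (fun r => Φ.flow r z) s i).2‖ / 2) *
              ‖(Φ.flow s z i).2 - (Function.leftLim (fun r => Φ.flow r z) s i).2‖ else 0)) ∂P ≤
      ENNReal.ofReal (4 * C * w * ((N + 1 : ℕ) : ℝ) ^ 2 * hsDiameter σ N ^ 2) *
        ∫⁻ p, ENNReal.ofReal ‖p.2 - p.1‖ *
          ENNReal.ofReal (if K ^ 2 < ‖p.1‖ ^ 2 + ‖p.2‖ ^ 2 then 2 * ((1 + ‖p.1‖ + ‖p.2‖) * ‖p.1 - p.2‖) else 0) ∂(γ.prod γ) := by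
  have hmean := CollisionEnergyExchangeMeanBound.lintegral_windowCollisionSum_le_of_pairEnvelope hσ Φ P hP s₁
    hw hC γ henv (measurable_fastMark K)
  dsimp only at hmean
  have hgood : ∀ᵐ z ∂P, z ∈ Φ.good := mem_ae_iff.2 hP
  calc _ ≤ ∫⁻ z, (∑ᶠ s ∈ collisionTimes (Torus.geometry (Fin 3)) (hsDiameter σ N) (fun t => Φ.flow t z) ∩
            Set.Icc s₁ (s₁ + w),
          ∑ i : Fin (N + 1), ∑ j : Fin (N + 1),
            (if i ≠ j ∧ ‖(Torus.geometry (Fin 3)).sepVec (Φ.flow s z i).1 (Φ.flow s z j).1‖ = hsDiameter σ N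
              then ENNReal.ofReal (if K ^ 2 < ‖(Φ.flow s z i).2‖ ^ 2 + ‖(Φ.flow s z j).2‖ ^ 2 then 2 * ((1 + ‖(Φ.flow s z i).2‖ + ‖(Φ.flow s z j).2‖) * ‖(Φ.flow s z i).2 - (Φ.flow s z j).2‖) else 0) else 0)) ∂P :=
        lintegral_mono_ae (hgood.mono fun z hz => ofReal_windowThroughput_le_markSum (Φ.isTrajectory z hz) hK s₁ w)
    _ ≤ _ := hmean

/-! ## §4 The per-window statement at a fixed profile, from a pair envelope of the evolved law -/

/-- **The per-window fast-collision throughput at a fixed profile, from a pair envelope of the evolved law.**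
For profile data `(a₀, u₀, θ₀)` (any functions) and `σ₀`: IF for all `0 < σ < σ₀`, all flow families and
horizons `τ > 0` the pair marginals of the evolved local Gibbs law on `[0, τ]` are eventually-in-`N` dominated
by `C · (Haar ⊗ N(u, θ))^{⊗2}` (the pair conjunct of hypothesis (A) of crux `CollisionRate`, stmt-13481), THEN
the per-window statement holds for this profile with threshold `σ₀`, UNGUARDED.  Given `t < T` and `η' > 0`:
the envelope is read on the horizon `[0, t + 1]` (constant `C`); the level `K₀ ∈ ℕ` is fixed by the vanishing
Gaussian fast tail (`tendsto_fastMarkFlux`) against the `τ, N, s`-free constant `4 C σ²` — the normalisation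
`(τ (N+1))⁻¹ · 4 C (τ ν_N) (N+1)² ε_N² = 4 C σ²`, `ν_N = (N+1)^{-1/3}` — and `∀ K ≥ K₀` by `fastMark_antitone`;
`τ₀ = 1`; `N₀(τ)` makes `τ ν_N ≤ 1` (every window `[s, s + τ ν_N]`, `s ≤ t`, lies in the horizon) and exceeds
the envelope's threshold.  The Euler solution and the initial convergence are not used. -/
theorem fastCollisionThroughputWAt_of_pairEnvelope {a₀ θ₀ : T3 → ℝ} {u₀ : T3 → V3} {σ₀ : ℝ}
    (hA : ∀ σ : ℝ, 0 < σ → σ < σ₀ →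
      ∀ Φ : (N : ℕ) → HardSphereFlow (Torus.geometry (Fin 3)) (hsDiameter σ N) (N + 1),
      ∀ τ : ℝ, 0 < τ → ∃ C : ℝ, 0 ≤ C ∧ ∃ u : V3, ∃ θ : ℝ, 0 < θ ∧ ∃ N₀ : ℕ, ∀ N : ℕ, N₀ ≤ N →
      ∀ t ∈ Set.Icc (0 : ℝ) τ,
        ∀ i j : Fin (N + 1), i ≠ j → ∀ f : (T3 × V3) × (T3 × V3) → ℝ≥0∞, Measurable f →
          ∫⁻ z, f ((Φ N).flow t z i, (Φ N).flow t z j) ∂(localGibbsLaw σ a₀ u₀ θ₀ N (Φ N)) ≤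
            ENNReal.ofReal C * ∫⁻ q, f q ∂(((volume : Measure T3).prod (gaussMeasure u θ)).prod
              ((volume : Measure T3).prod (gaussMeasure u θ)))) :
    ∀ σ : ℝ, 0 < σ → σ < σ₀ → ∀ (T : ℝ) (ρ θ : ℝ → T3 → ℝ) (u : ℝ → T3 → V3),
      IsHardSphereEulerSolution σ T ρ u θ →
      ∀ Φ : (N : ℕ) → HardSphereFlow (Torus.geometry (Fin 3)) (hsDiameter σ N) (N + 1),
        TendstoHydroFieldsAt (fun N => localGibbsLaw σ a₀ u₀ θ₀ N (Φ N)) Φ ρ u θ 0 →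
        ∀ t ∈ Set.Ico 0 T, ∀ η' : ℝ, 0 < η' → ∃ K₀ : ℝ, ∀ K : ℝ, K₀ ≤ K →
        ∃ τ₀ : ℝ, 0 < τ₀ ∧ ∀ τ : ℝ, τ₀ ≤ τ → ∃ N₀ : ℕ, ∀ N : ℕ, N₀ ≤ N → ∀ s ∈ Set.Icc 0 t,
          ∫⁻ z, ENNReal.ofReal ((τ * ((N : ℝ) + 1))⁻¹ * ∑ i : Fin (N + 1),
            ∑ᶠ s' ∈ collisionTimes (Torus.geometry (Fin 3)) (hsDiameter σ N) (fun r => (Φ N).flow r z) ∩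
                Set.Ioc s (s + τ * ((N : ℝ) + 1) ^ (-(1 / 3 : ℝ))),
              (if K < max ‖(Function.leftLim (fun r => (Φ N).flow r z) s' i).2‖ ‖((Φ N).flow s' z i).2‖
                then (1 + ‖((Φ N).flow s' z i).2 + (Function.leftLim (fun r => (Φ N).flow r z) s' i).2‖ / 2) *
                  ‖((Φ N).flow s' z i).2 - (Function.leftLim (fun r => (Φ N).flow r z) s' i).2‖
                else 0)) ∂(localGibbsLaw σ a₀ u₀ θ₀ N (Φ N)) ≤ ENNReal.ofReal η' := by
  intro σ hσ hσlt T ρ θ u _hsol Φ _h0 t ht η' hη'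
  have hτh : (0 : ℝ) < t + 1 := by linarith [ht.1]
  obtain ⟨C, hC, u', θ', hθ', N₁, hN₁⟩ := hA σ hσ hσlt Φ (t + 1) hτh
  -- the level `K₀`: the Gaussian fast tail of the collision flux is eventually below `η' / (4 C σ²)`
  have hlim : Tendsto (fun n : ℕ => ENNReal.ofReal (4 * C * σ ^ 2) *
      ∫⁻ p, ENNReal.ofReal ‖p.2 - p.1‖ *
        ENNReal.ofReal (if (n : ℝ) ^ 2 < ‖p.1‖ ^ 2 + ‖p.2‖ ^ 2 then 2 * ((1 + ‖p.1‖ + ‖p.2‖) * ‖p.1 - p.2‖) else 0)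
          ∂((gaussMeasure u' θ').prod (gaussMeasure u' θ'))) atTop (𝓝 0) := by
    simpa only [mul_zero] using
      ENNReal.Tendsto.const_mul (tendsto_fastMarkFlux u' hθ') (Or.inr ENNReal.ofReal_ne_top)
  obtain ⟨K₀, hK₀⟩ := ENNReal.tendsto_atTop_zero.1 hlim (ENNReal.ofReal η') (ENNReal.ofReal_pos.2 hη')
  refine ⟨(K₀ : ℝ), fun K hK => ⟨1, one_pos, fun τ hτ => ?_⟩⟩
  have hK0 : (0 : ℝ) ≤ K := (Nat.cast_nonneg K₀).trans hK
  have hτ0 : 0 < τ := one_pos.trans_le hτ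
  -- the threshold in `N`: the envelope's, and `τ ν_N ≤ 1`
  have hν : Tendsto (fun N : ℕ => ((N : ℝ) + 1) ^ (-(1 / 3 : ℝ))) atTop (𝓝 0) :=
    (tendsto_rpow_neg_atTop (by norm_num : (0 : ℝ) < 1 / 3)).comp
      (tendsto_atTop_add_const_right _ 1 tendsto_natCast_atTop_atTop)
  obtain ⟨N₂, hN₂⟩ := eventually_atTop.1 (hν.eventually_le_const (inv_pos.2 hτ0))
  refine ⟨max N₁ N₂, fun N hN s hs => ?_⟩
  have hNN1 : N₁ ≤ N := (le_max_left _ _).trans hN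
  have hNN2 : N₂ ≤ N := (le_max_right _ _).trans hN
  have hN0 : (0 : ℝ) < (N : ℝ) + 1 := by positivity
  set ν : ℝ := ((N : ℝ) + 1) ^ (-(1 / 3 : ℝ)) with hνdef
  have hν0 : 0 < ν := Real.rpow_pos_of_pos hN0 _
  have hτν : 0 < τ * ν := mul_pos hτ0 hν0
  have hτν1 : τ * ν ≤ 1 := by
    have h := hN₂ N hNN2
    rw [← hνdef] at h
    calc τ * ν ≤ τ * τ⁻¹ := mul_le_mul_of_nonneg_left h hτ0.le
      _ = 1 := mul_inv_cancel₀ hτ0.ne'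
  -- the true law is carried by the good set; its pair envelope at the times of the window
  have hPgood : localGibbsLaw σ a₀ u₀ θ₀ N (Φ N) (Φ N).goodᶜ = 0 := by
    rw [localGibbsLaw_eq]
    exact localGibbsMeasure_absolutelyContinuous σ _ _ _ N (Φ N) (Φ N).measure_compl_good
  have henv : ∀ r ∈ Set.Icc s (s + τ * ν), ∀ i j : Fin (N + 1), i ≠ j →
      ∀ f : (T3 × V3) × (T3 × V3) → ℝ≥0∞, Measurable f →
      ∫⁻ z, f ((Φ N).flow r z i, (Φ N).flow r z j) ∂(localGibbsLaw σ a₀ u₀ θ₀ N (Φ N)) ≤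
        ENNReal.ofReal C * ∫⁻ q, f q ∂(((volume : Measure T3).prod (gaussMeasure u' θ')).prod
          ((volume : Measure T3).prod (gaussMeasure u' θ'))) :=
    fun r hr i j hij f hf =>
      hN₁ N hNN1 r ⟨hs.1.trans hr.1, hr.2.trans (by linarith [hs.2])⟩ i j hij f hf
  -- the normalisation `(τ (N+1))⁻¹ · 4 C (τ ν_N) (N+1)² ε_N² = 4 C σ²`
  have hnorm : τ * ν * ((N + 1 : ℕ) : ℝ) ^ 2 * hsDiameter σ N ^ 2 = τ * σ ^ 2 * ((N : ℝ) + 1) := by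
    have hν3 : ν ^ 3 = ((N : ℝ) + 1)⁻¹ := by
      rw [hνdef, ← Real.rpow_natCast, ← Real.rpow_mul hN0.le,
        show (-(1 / 3 : ℝ)) * ((3 : ℕ) : ℝ) = -1 by norm_num, Real.rpow_neg_one]
    have hcast : ((N + 1 : ℕ) : ℝ) = (N : ℝ) + 1 := by push_cast; ring
    have hεN : hsDiameter σ N = σ * ν := by
      rw [hνdef, hsDiameter]
      push_cast
      ring
    rw [hεN, hcast, show τ * ν * ((N : ℝ) + 1) ^ 2 * (σ * ν) ^ 2 = τ * σ ^ 2 * ((N : ℝ) + 1) ^ 2 * ν ^ 3 by ring,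
      hν3]
    field_simp
  have hconst : (τ * ((N : ℝ) + 1))⁻¹ * (4 * C * (τ * ν) * ((N + 1 : ℕ) : ℝ) ^ 2 * hsDiameter σ N ^ 2) =
      4 * C * σ ^ 2 := by
    have heq : 4 * C * (τ * ν) * ((N + 1 : ℕ) : ℝ) ^ 2 * hsDiameter σ N ^ 2 =
        4 * C * σ ^ 2 * (τ * ((N : ℝ) + 1)) := by
      calc 4 * C * (τ * ν) * ((N + 1 : ℕ) : ℝ) ^ 2 * hsDiameter σ N ^ 2
          = 4 * C * (τ * ν * ((N + 1 : ℕ) : ℝ) ^ 2 * hsDiameter σ N ^ 2) := by ring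
        _ = 4 * C * σ ^ 2 * (τ * ((N : ℝ) + 1)) := by rw [hnorm]; ring
    rw [heq, ← mul_assoc, mul_comm ((τ * ((N : ℝ) + 1))⁻¹), mul_assoc,
      inv_mul_cancel₀ (mul_pos hτ0 hN0).ne', mul_one]
  have hc0 : (0 : ℝ) ≤ (τ * ((N : ℝ) + 1))⁻¹ := by positivity
  have hw0 : (0 : ℝ) ≤ 4 * C * (τ * ν) * ((N + 1 : ℕ) : ℝ) ^ 2 * hsDiameter σ N ^ 2 := by positivity
  -- the chain
  calc _ = ENNReal.ofReal ((τ * ((N : ℝ) + 1))⁻¹) * ∫⁻ z, ENNReal.ofReal (∑ i : Fin (N + 1),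
          ∑ᶠ s' ∈ collisionTimes (Torus.geometry (Fin 3)) (hsDiameter σ N) (fun r => (Φ N).flow r z) ∩
              Set.Ioc s (s + τ * ν),
            (if K < max ‖(Function.leftLim (fun r => (Φ N).flow r z) s' i).2‖ ‖((Φ N).flow s' z i).2‖
              then (1 + ‖((Φ N).flow s' z i).2 + (Function.leftLim (fun r => (Φ N).flow r z) s' i).2‖ / 2) *
                ‖((Φ N).flow s' z i).2 - (Function.leftLim (fun r => (Φ N).flow r z) s' i).2‖
              else 0)) ∂(localGibbsLaw σ a₀ u₀ θ₀ N (Φ N)) := by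
        rw [← lintegral_const_mul' _ _ ENNReal.ofReal_ne_top]
        refine lintegral_congr fun z => ?_
        rw [← ENNReal.ofReal_mul hc0]
    _ ≤ ENNReal.ofReal ((τ * ((N : ℝ) + 1))⁻¹) *
          (ENNReal.ofReal (4 * C * (τ * ν) * ((N + 1 : ℕ) : ℝ) ^ 2 * hsDiameter σ N ^ 2) *
            ∫⁻ p, ENNReal.ofReal ‖p.2 - p.1‖ *
              ENNReal.ofReal (if K ^ 2 < ‖p.1‖ ^ 2 + ‖p.2‖ ^ 2 then 2 * ((1 + ‖p.1‖ + ‖p.2‖) * ‖p.1 - p.2‖) else 0)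
                ∂((gaussMeasure u' θ').prod (gaussMeasure u' θ'))) :=
        mul_le_mul' le_rfl (lintegral_windowThroughput_le_of_pairEnvelope hσ (Φ N) _ hPgood s hτν hC
          (gaussMeasure u' θ') henv hK0)
    _ ≤ ENNReal.ofReal ((τ * ((N : ℝ) + 1))⁻¹) *
          (ENNReal.ofReal (4 * C * (τ * ν) * ((N + 1 : ℕ) : ℝ) ^ 2 * hsDiameter σ N ^ 2) *
            ∫⁻ p, ENNReal.ofReal ‖p.2 - p.1‖ *
              ENNReal.ofReal (if (K₀ : ℝ) ^ 2 < ‖p.1‖ ^ 2 + ‖p.2‖ ^ 2 then 2 * ((1 + ‖p.1‖ + ‖p.2‖) * ‖p.1 - p.2‖) else 0)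
                ∂((gaussMeasure u' θ').prod (gaussMeasure u' θ'))) :=
        mul_le_mul' le_rfl (mul_le_mul' le_rfl
          (lintegral_fastMarkFlux_antitone _ (Nat.cast_nonneg K₀) hK))
    _ = ENNReal.ofReal (4 * C * σ ^ 2) *
          ∫⁻ p, ENNReal.ofReal ‖p.2 - p.1‖ *
            ENNReal.ofReal (if (K₀ : ℝ) ^ 2 < ‖p.1‖ ^ 2 + ‖p.2‖ ^ 2 then 2 * ((1 + ‖p.1‖ + ‖p.2‖) * ‖p.1 - p.2‖) else 0)
              ∂((gaussMeasure u' θ').prod (gaussMeasure u' θ')) := by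
        rw [← mul_assoc, ← ENNReal.ofReal_mul hc0, hconst]
    _ ≤ ENNReal.ofReal η' := hK₀ K₀ le_rfl

/-! ## §5 The registered glue -/

/-- **Wave-4 glue, BY NAME (registered `glue_fastCollisionThroughputW_of_lanfordEnvelopeR`): the PER-WINDOW
fast-collision throughput, UNGUARDED, FOLLOWS from the crux item `Theses.BGEndpointRigidity.LanfordEnvelopeR`**
(stmt-AtomisticToContinuum-13677: the Lanford/BGSR Gaussian envelope of all volume-marginals of the evolved
local Gibbs law up to any horizon, read on the hard-sphere domain — OPEN at positive times):
`LanfordEnvelopeR` ⟹ (A) (`CollisionRate.stub_marginalEnvelopeLG_of_lanfordEnvelopeR`, pair conjunct) ⟹ the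
per-window statement (`fastCollisionThroughputWAt_of_pairEnvelope`).  Along every classical hs-Euler solution
and flow family with local Gibbs data: `∀ t < T ∀ η' > 0 ∃ K₀ ∀ K ≥ K₀ ∃ τ₀ > 0 ∀ τ ≥ τ₀ ∃ N₀ ∀ N ≥ N₀
∀ s ∈ [0, t]`, `(τ (N+1))⁻¹ E[Σᵢ Σ_{collision times s' ∈ (s, s + τ (N+1)^{-1/3}]} 𝟙{K < max(‖vᵢ(s'⁻)‖, ‖vᵢ(s')‖)}
(1 + ‖vᵢ(s') + vᵢ(s'⁻)‖/2) ‖vᵢ(s') − vᵢ(s'⁻)‖] ≤ η'` — the fast half of the per-window invisible-collision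
throughput of AUDIT-4a §2(e1) (v7 stub 4a-iii). [cite: CIP1994, App. 4.A] -/
theorem glue_fastCollisionThroughputW_of_lanfordEnvelopeR : Summit.AtomisticToContinuum.HydrodynamicLimit.Theses.BGEndpointRigidity.LanfordEnvelopeR → ∀ (a₀ θ₀ : Literature.MathematicalPhysics.KineticTheory.T3 → ℝ) (u₀ : Literature.MathematicalPhysics.KineticTheory.T3 → Literature.MathematicalPhysics.KineticTheory.V3), Continuous a₀ → Continuous θ₀ → Continuous u₀ → (∀ x, 0 < a₀ x) → (∀ x, 0 < θ₀ x) → ∃ σ₀ : ℝ, 0 < σ₀ ∧ ∀ σ : ℝ, 0 < σ → σ < σ₀ → ∀ (T : ℝ) (ρ θ : ℝ → Literature.MathematicalPhysics.KineticTheory.T3 → ℝ) (u : ℝ → Literature.MathematicalPhysics.KineticTheory.T3 → Literature.MathematicalPhysics.KineticTheory.V3), Literature.MathematicalPhysics.KineticTheory.IsHardSphereEulerSolution σ T ρ u θ → ∀ Φ : (N : ℕ) → Literature.Analysis.FluidPDE.HardSphereFlow (Literature.Analysis.FluidPDE.Torus.geometry (Fin 3)) (Literature.MathematicalPhysics.KineticTheory.hsDiameter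 σ N) (N + 1), Literature.MathematicalPhysics.KineticTheory.TendstoHydroFieldsAt (fun N => Literature.MathematicalPhysics.KineticTheory.localGibbsLaw σ a₀ u₀ θ₀ N (Φ N)) Φ ρ u θ 0 → ∀ t ∈ Set.Ico 0 T, ∀ η' : ℝ, 0 < η' → ∃ K₀ : ℝ, ∀ K : ℝ, K₀ ≤ K → ∃ τ₀ : ℝ, 0 < τ₀ ∧ ∀ τ : ℝ, τ₀ ≤ τ → ∃ N₀ : ℕ, ∀ N : ℕ, N₀ ≤ N → ∀ s ∈ Set.Icc 0 t, ∫⁻ z, ENNReal.ofReal ((τ * ((N : ℝ) + 1))⁻¹ * ∑ i : Fin (N + 1), ∑ᶠ s' ∈ Literature.Analysis.FluidPDE.collisionTimes (Literature.Analysis.FluidPDE.Torus.geometry (Fin 3)) (Literature.MathematicalPhysics.KineticTheory.hsDiameter σ N) (fun r => (Φ N).flow r z) ∩ Set.Ioc s (s + τ * ((N : ℝ) + 1) ^ (-(1 / 3 : ℝ))), (if K < max ‖(Function.leftLim (fun r => (Φ N).flow r z) s' i).2‖ ‖((Φ N).flow s' z i).2‖ then (1 + ‖((Φ N).flow s' z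 i).2 + (Function.leftLim (fun r => (Φ N).flow r z) s' i).2‖ / 2) * ‖((Φ N).flow s' z i).2 - (Function.leftLim (fun r => (Φ N).flow r z) s' i).2‖ else 0)) ∂(Literature.MathematicalPhysics.KineticTheory.localGibbsLaw σ a₀ u₀ θ₀ N (Φ N)) ≤ ENNReal.ofReal η' := by
  intro hL a₀ θ₀ u₀ ha hθ hu ha0 hθ0
  obtain ⟨σ₀, hσ₀, hA'⟩ := CollisionRate.stub_marginalEnvelopeLG_of_lanfordEnvelopeR hL a₀ θ₀ u₀ ha hθ hu ha0 hθ0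
  refine ⟨σ₀, hσ₀, fastCollisionThroughputWAt_of_pairEnvelope fun σ hσ hσlt Φ τ hτ => ?_⟩
  obtain ⟨C, hC, u, θ, hθ', N₀, hN⟩ := hA' σ hσ hσlt Φ τ hτ
  exact ⟨C, hC, u, θ, hθ', N₀, fun N hNN t ht => (hN N hNN t ht).1⟩

/-- **Guarded corollary (registered shape of v7's 4a-iii fast half: `LanfordEnvelopeR → ∀ η, FastCollisionThroughputW η`).**
For EVERY packing level `η` the per-window fast-collision throughput holds along guarded solutions
(`∀ t ∈ [0,T) ∀ x, ρ_t(x) σ³ < η`): the guard is ignored (`glue_fastCollisionThroughputW_of_lanfordEnvelopeR`).  The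
conclusion is the body of the Defs-module object `LTEInBand.FastCollisionThroughputW η`, inline-expanded. -/
theorem glue_fastCollisionThroughputW_inBand_of_lanfordEnvelopeR : Summit.AtomisticToContinuum.HydrodynamicLimit.Theses.BGEndpointRigidity.LanfordEnvelopeR → ∀ (η : ℝ) (a₀ θ₀ : Literature.MathematicalPhysics.KineticTheory.T3 → ℝ) (u₀ : Literature.MathematicalPhysics.KineticTheory.T3 → Literature.MathematicalPhysics.KineticTheory.V3), Continuous a₀ → Continuous θ₀ → Continuous u₀ → (∀ x, 0 < a₀ x) → (∀ x, 0 < θ₀ x) → ∃ σ₀ : ℝ, 0 < σ₀ ∧ ∀ σ : ℝ, 0 < σ → σ < σ₀ → ∀ (T : ℝ) (ρ θ : ℝ → Literature.MathematicalPhysics.KineticTheory.T3 → ℝ) (u : ℝ → Literature.MathematicalPhysics.KineticTheory.T3 → Literature.MathematicalPhysics.KineticTheory.V3), Literature.MathematicalPhysics.KineticTheory.IsHardSphereEulerSolution σ T ρ u θ → (∀ t ∈ Set.Ico 0 T, ∀ x, ρ t x * σ ^ 3 < η) → ∀ Φ : (N : ℕ) → Literature.Analysis.FluidPDE.HardSphereFlow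 (Literature.Analysis.FluidPDE.Torus.geometry (Fin 3)) (Literature.MathematicalPhysics.KineticTheory.hsDiameter σ N) (N + 1), Literature.MathematicalPhysics.KineticTheory.TendstoHydroFieldsAt (fun N => Literature.MathematicalPhysics.KineticTheory.localGibbsLaw σ a₀ u₀ θ₀ N (Φ N)) Φ ρ u θ 0 → ∀ t ∈ Set.Ico 0 T, ∀ η' : ℝ, 0 < η' → ∃ K₀ : ℝ, ∀ K : ℝ, K₀ ≤ K → ∃ τ₀ : ℝ, 0 < τ₀ ∧ ∀ τ : ℝ, τ₀ ≤ τ → ∃ N₀ : ℕ, ∀ N : ℕ, N₀ ≤ N → ∀ s ∈ Set.Icc 0 t, ∫⁻ z, ENNReal.ofReal ((τ * ((N : ℝ) + 1))⁻¹ * ∑ i : Fin (N + 1), ∑ᶠ s' ∈ Literature.Analysis.FluidPDE.collisionTimes (Literature.Analysis.FluidPDE.Torus.geometry (Fin 3)) (Literature.MathematicalPhysics.KineticTheory.hsDiameter σ N) (fun r => (Φ N).flow r z) ∩ Set.Ioc s (s + τ * ((N : ℝ) + 1) ^ (-(1 / 3 : ℝ))), (if K < max ‖(Function.leftLim (fun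 r => (Φ N).flow r z) s' i).2‖ ‖((Φ N).flow s' z i).2‖ then (1 + ‖((Φ N).flow s' z i).2 + (Function.leftLim (fun r => (Φ N).flow r z) s' i).2‖ / 2) * ‖((Φ N).flow s' z i).2 - (Function.leftLim (fun r => (Φ N).flow r z) s' i).2‖ else 0)) ∂(Literature.MathematicalPhysics.KineticTheory.localGibbsLaw σ a₀ u₀ θ₀ N (Φ N)) ≤ ENNReal.ofReal η' := by
  intro hL η a₀ θ₀ u₀ ha hθ hu ha0 hθ0
  obtain ⟨σ₀, hσ₀, G⟩ := glue_fastCollisionThroughputW_of_lanfordEnvelopeR hL a₀ θ₀ u₀ ha hθ hu ha0 hθ0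
  exact ⟨σ₀, hσ₀, fun σ hσ hσ' T ρ θ u hE _ => G σ hσ hσ' T ρ θ u hE⟩

end Summit.AtomisticToContinuum.HydrodynamicLimit.Theorems.LTEInBand

end
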